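import Summits.Ventures.LatticeQCDFlow.Scaling.SimulatedTemperingModeGap
import Summits.Ventures.LatticeQCDFlow.Scaling.EquilibriumExitCeiling
import Literature.Probability.MarkovChains.SpectralGapTestFunction
import Literature.Probability.MarkovChains.SpectralGapVariational

/-!
HONEST FRAMING: exact (Metropolis-corrected) sampling algorithms for lattice gauge theory; figures
of merit are autocorrelation/cost numbers at stated couplings and volumes; no continuum-physics
claim.

# SimulatedTemperingTunnelingTime — THE EQUILIBRIUM TIME UNTIL THE SIMULATED-TEMPERING SAMPLER SITS AT LEVEL `k` IN
# SECTOR `j` IS AT MOST `(1 − μ_k(A_j)/(K+1))·25(K+1)²/(pγ_A·min{δ/K, γ₀}·μ_k(A_j))` — TUNNELLING AT THE COLD LEVEL IS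
# IMPORTED FROM THE HOT LEVEL IN POLYNOMIAL TIME (lean-2 GEN-18, ours)

Venture-side (OURS).  Cell `lqcd-flow` (pub-lqcd), unit `pub-lqcd-lean-2-g18`, 2026-08-25.  The simulated-tempering
companion of `Scaling/ReplicaExchangeTunnelingTime` and the positive counterpart of the metastability bounds
`Scaling/SimulatedTemperingSectorHitting` / `Scaling/SectorExitProbability` (GEN-17): the generic ceiling
`Scaling/EquilibriumExitCeiling` (`Σ_x π(x)E_x(τ_A ∧ N) ≤ π(Aᶜ)/(γπ(A))`) applied to `P = stFinSampler ½ μ M` with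
`A = {(k, x) : mode x = j}` at a fixed level `k` (mass `μ_k(A_j)/(K+1)`) and chapter Y's gap floor
`Scaling/SimulatedTemperingModeGap.stFinModeHalf_spectralGap_ge` (within-mode gaps `γ_A`, hot global gap `γ₀`,
mode-restricted overlaps `δ`, persistence `p`).

## What is proved

* §1 uses `Literature…LevinPeres2017_remark_13_8` (generic, reversible, `|X| ≥ 2`: `Gap·Var_π(f) ≤ 𝓔_π(P; f)` for every
  `f`; Levin–Peres Lemma 13.7 + Remark 13.8, PROVED in `Literature/…/SpectralGapVariational`) — imported, not restated.
* §2 `stFin_levelSector_mass` — `π{(k, x) : mode x = j} = μ_k(A_j)/(K+1)`.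
* §3 **`stFinMode_tunnelingTime_le`** — for every level `k`, sector `j`, horizon `N`:
  `Σ_p π(p)·E_p(τ_{level k, sector j} ∧ N) ≤ (1 − μ_k(A_j)/(K+1))/(c·μ_k(A_j)/(K+1))`, `c = pγ_A·min{δ/K, γ₀}/(25(K+1))`.

NOT CLAIMED: pointwise starts; tail bounds; anything measured.  Literature grade (cell rule): KNOWN MECHANISM (mean
hitting times vs relaxation time, Aldous–Fill Ch. 3), NEW TYPING; nothing cited as a fact; no new bib keys.
-/

noncomputable section

open Finset Function
open Literature.Probability.MarkovChains
open Literature.Probability.MarkovChains.Decomposition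

namespace Summit.Ventures.LatticeQCDFlow.Scaling

/-! ## §2–§3 Simulated tempering -/

section Tunnel

variable {S J : Type*} [Fintype S] [DecidableEq S] [Fintype J] [DecidableEq J] {K : ℕ}
  {μ : Fin (K + 1) → S → ℝ} {M : Fin (K + 1) → Matrix S S ℝ} {mode : S → J}

omit [DecidableEq S] [Fintype J] in
/-- **`π{(k, x) : mode x = j} = μ_k(A_j)/(K+1)`.** [ours] -/
theorem stFin_levelSector_mass (k : Fin (K + 1)) (j : J) :
    ∑ p ∈ univ.filter (fun p : Fin (K + 1) × S => p.1 = k ∧ mode p.2 = j), stFinLaw μ p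
      = blockMass (μ k) mode j / (K + 1) := by
  rw [sum_filter, Fintype.sum_prod_type]
  unfold stFinLaw blockMass block
  rw [sum_filter, Finset.sum_div]
  rw [Finset.sum_eq_single k]
  · refine sum_congr rfl fun x _ => ?_
    by_cases hx : mode x = j
    · simp [hx]
    · simp [hx]
  · intro k' _ hk'
    exact sum_eq_zero fun x _ => by rw [if_neg (fun h => hk' h.1)]
  · intro h; exact absurd (mem_univ k) h

omit [Fintype J] in
/-- The complement mass: `1 − μ_k(A_j)/(K+1)`. [ours] -/
theorem stFin_levelSector_mass_compl (hμ1 : ∀ k, ∑ x, μ k x = 1) (k : Fin (K + 1)) (j : J) :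
    ∑ p ∈ (univ.filter (fun p : Fin (K + 1) × S => p.1 = k ∧ mode p.2 = j))ᶜ, stFinLaw μ p
      = 1 - blockMass (μ k) mode j / (K + 1) := by
  rw [← stFin_levelSector_mass k j, ← sum_stFinLaw hμ1,
    ← sum_add_sum_compl (univ.filter (fun p : Fin (K + 1) × S => p.1 = k ∧ mode p.2 = j))]
  ring

/-- **TUNNELLING-TIME CEILING FOR SIMULATED TEMPERING.**  Reversible within-level updates with within-mode Poincaré
constant `γ_A`, a GLOBAL Poincaré constant `γ₀` of the hot update, mode-restricted overlaps `δ` and persistence `p`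
(`p, δ, γ_A ≤ 1`, `K ≥ 1`): for every level `k`, sector `j` and horizon `N`,
`Σ_p π(p)·E_p(τ_{level k ∧ sector j} ∧ N) ≤ (1 − μ_k(A_j)/(K+1))/(c·(μ_k(A_j)/(K+1)))`,
`c = pγ_A·min{δ/K, γ₀}/(25(K+1))`. [ours] -/
theorem stFinMode_tunnelingTime_le (hμ : ∀ k x, 0 < μ k x) (hμ1 : ∀ k, ∑ x, μ k x = 1)
    (hmode : Function.Surjective mode) (hK : 1 ≤ K) (hM : ∀ k, IsRowStochastic (M k))
    (hMrev : ∀ k, DetailedBalance (μ k) (M k))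
    {p δ γ₀ γA : ℝ} (hp : 0 < p) (hp1 : p ≤ 1) (hδ0 : 0 < δ) (hδ1 : δ ≤ 1) (hγ₀ : 0 < γ₀)
    (hγA : 0 < γA) (hγA1 : γA ≤ 1)
    (hpers : ∀ (k l : Fin (K + 1)) (j : J), k ≤ l → p * blockMass (μ l) mode j ≤ blockMass (μ k) mode j)
    (hδ : ∀ (l : Fin K) (j : J), δ * min (blockMass (μ l.castSucc) mode j) (blockMass (μ l.succ) mode j)
      ≤ ∑ x ∈ block mode j, min (μ l.castSucc x) (μ l.succ x))
    (hgap0 : ∀ h : S → ℝ, γ₀ * lawVariance (μ 0) h ≤ dirichletForm (μ 0) (M 0) h)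
    (hgapA : ∀ k j, ∀ h : S → ℝ, γA * lawVariance (blockLaw (μ k) mode j) h
      ≤ dirichletForm (blockLaw (μ k) mode j) (restrictionChain (M k) mode) h)
    (k : Fin (K + 1)) (j : J) (N : ℕ) :
    ∑ q, stFinLaw μ q * meanHitWithin (stFinSampler (1 / 2) μ M)
        (↑(univ.filter (fun p : Fin (K + 1) × S => p.1 = k ∧ mode p.2 = j)) : Set (Fin (K + 1) × S)) N q
      ≤ (1 - blockMass (μ k) mode j / (K + 1))
          / (p * γA * min (δ / K) γ₀ / (25 * (K + 1)) * (blockMass (μ k) mode j / (K + 1))) := by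
  haveI : Nonempty S := by
    by_contra h
    rw [not_nonempty_iff] at h
    have := hμ1 0
    rw [Finset.univ_eq_empty, Finset.sum_empty] at this
    exact zero_ne_one this
  haveI : Nontrivial (Fin (K + 1)) := Fin.nontrivial_iff_two_le.mpr (by omega)
  have ht0 : (0 : ℝ) < 1 / 2 := by norm_num
  have ht1 : (1 / 2 : ℝ) < 1 := by norm_num
  have hKr : (1 : ℝ) ≤ K := by exact_mod_cast hK
  have hP := stFinSampler_isRowStochastic (M := M) hμ hM ht0.le ht1.le
  have hDB := stFinSampler_detailedBalance (t := (1 / 2 : ℝ)) (M := M) hμ hMrev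
  have hst : IsStationary (stFinLaw μ) (stFinSampler (1 / 2) μ M) := hDB.isStationary hP.2
  set c := p * γA * min (δ / K) γ₀ / (25 * (K + 1)) with hcdef
  have hm : 0 < min (δ / K) γ₀ := lt_min (div_pos hδ0 (by linarith)) hγ₀
  have hcpos : 0 < c := by positivity
  have hc : c ≤ spectralGap (stFinLaw μ) (stFinSampler (1 / 2) μ M) :=
    stFinModeHalf_spectralGap_ge hμ hμ1 hmode hK hM hMrev hp hp1 hδ0 hδ1 hγ₀ hγA hγA1 hpers hδ hgap0 hgapA
  have hgap : ∀ f : Fin (K + 1) × S → ℝ,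
      c * lawVariance (stFinLaw μ) f ≤ dirichletForm (stFinLaw μ) (stFinSampler (1 / 2) μ M) f := fun f =>
    (mul_le_mul_of_nonneg_right hc (lawVariance_nonneg (fun q => (stFinLaw_pos hμ q).le) f)).trans
      (LevinPeres2017_remark_13_8 (stFinLaw_pos hμ) (sum_stFinLaw hμ1) hP hDB f)
  have hA : 0 < ∑ p ∈ univ.filter (fun p : Fin (K + 1) × S => p.1 = k ∧ mode p.2 = j), stFinLaw μ p := by
    rw [stFin_levelSector_mass k j]; exact div_pos (blockMass_pos (hμ k) hmode j) (by positivity)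
  have h := equilibrium_meanHitWithin_le (fun q => (stFinLaw_pos hμ q).le) (sum_stFinLaw hμ1) hP hst hcpos hgap _ hA N
  rw [stFin_levelSector_mass k j] at h
  rw [stFin_levelSector_mass_compl hμ1 k j] at h
  exact h

end Tunnel

end Summit.Ventures.LatticeQCDFlow.Scaling
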